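import Summits.CriticalPhenomena.PercolationContinuityZ3.Theorems.PercNearOneGluingNoHeavyLowerTailSahiCombMixFour
import Summits.CriticalPhenomena.PercolationContinuityZ3.Theorems.PercNearOneGluingNoHeavyLowerTailSahiCombMixCellsK1a
import Summits.CriticalPhenomena.PercolationContinuityZ3.Theorems.PercNearOneGluingNoHeavyLowerTailSahiCombMixCellsK1b
import Summits.CriticalPhenomena.PercolationContinuityZ3.Theorems.PercNearOneGluingNoHeavyLowerTailSahiCombMixCellsK1c
import Summits.CriticalPhenomena.PercolationContinuityZ3.Theorems.PercNearOneGluingNoHeavyLowerTailSahiCombMixCellsK2a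
import Summits.CriticalPhenomena.PercolationContinuityZ3.Theorems.PercNearOneGluingNoHeavyLowerTailSahiCombMixCellsK2b
import Summits.CriticalPhenomena.PercolationContinuityZ3.Theorems.PercNearOneGluingNoHeavyLowerTailSahiCombMixCellsK2c
import Summits.CriticalPhenomena.PercolationContinuityZ3.Theorems.PercNearOneGluingNoHeavyLowerTailSahiCombMixCellsK2d
import Summits.CriticalPhenomena.PercolationContinuityZ3.Theorems.PercNearOneGluingNoHeavyLowerTailSahiCombMixCellsK2e
import Summits.CriticalPhenomena.PercolationContinuityZ3.Theorems.PercNearOneGluingNoHeavyLowerTailSahiCombMixCellsK2f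
import Summits.CriticalPhenomena.PercolationContinuityZ3.Theorems.PercNearOneGluingNoHeavyLowerTailSahiCombMixCellsK3a
import Summits.CriticalPhenomena.PercolationContinuityZ3.Theorems.PercNearOneGluingNoHeavyLowerTailSahiCombMixCellsK3b
import Summits.CriticalPhenomena.PercolationContinuityZ3.Theorems.PercNearOneGluingNoHeavyLowerTailSahiCombMixCellsK3c
import Summits.CriticalPhenomena.PercolationContinuityZ3.Theorems.PercNearOneGluingNoHeavyLowerTailSahiCombMixCellsK3d
import Summits.CriticalPhenomena.PercolationContinuityZ3.Theorems.PercNearOneGluingNoHeavyLowerTailSahiCombMixCellsK3e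
import Summits.CriticalPhenomena.PercolationContinuityZ3.Theorems.PercNearOneGluingNoHeavyLowerTailSahiCombMixCellsK3f
import Summits.CriticalPhenomena.PercolationContinuityZ3.Theorems.PercNearOneGluingNoHeavyLowerTailSahiCombMixCellsK3g
import Summits.CriticalPhenomena.PercolationContinuityZ3.Theorems.PercNearOneGluingNoHeavyLowerTailSahiCombMixCellsK3h

/-!
# The comb (tensor-Bernstein) hierarchy for Sahi's `E_k`, XXXVII: comb H-MIX(4) — the plain three-slot cells and the four DISPATCHERS `CombCanonThreeSlotCells k`

Support file of the one-cut programme (crux `NoHeavyLowerTail`, stmt-CriticalPhenomena-4575; cell `prim-masterthm`, seat P3, gen 8; HIERARCHY.md §15(d)).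
* `biInter_orCoord_of_forall_eq`, **`combPos_threeSlot_plain`** — a three-slot cell whose mixed set is constant on every index set is gen 4's order-3 disjunctive
  closure (`SahiCombDisjunct.combPos_sahiE_three_unionCoord`) applied to the member triple `(U_{K_0}, U_{K_1}, U_{K_2})` (increasing, ignoring `e`, cubic comb row from
  `CombHereditary`).
* **`combCanonThreeSlotCells_zero/one/two/three`** — the interfaces `SahiCombMix.CombCanonThreeSlotCells k` of `…SahiCombMixFour` DISCHARGED: case split on `G`,
  plain cells as above, the 34 non-plain cells by the lifted certificate cells of `…SahiCombMixCellsK*`.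
With `CombFourSingletonCells` (the four singleton four-slot cells, still to be lifted) `combHereditary_orCoord_four_of_cells` then gives comb H-MIX(4). [this work]
-/

noncomputable section

open scoped Classical

namespace Summit.CriticalPhenomena.PercolationContinuityZ3.Theorems

open Finset Function
open Literature.Combinatorics.Sahi2008
open Literature.Probability.Percolation.DecisionTree (ind ind_of_mem ind_of_not_mem ind_nonneg)
open SahiComb
open SahiCombDisjunct (orCoord)
open SahiCombHereditary (CombHereditary)

variable {ι : Type} [Fintype ι]

namespace SahiCombMix

/-! ### Plain cells -/

omit [Fintype ι] in
/-- If `G` is constant `= b` on `K`, the member `⋂_{i∈K} (U_i ∪ [G i]{e∈ω})` is `(⋂_{i∈K} U_i) ∪ [b]{e∈ω}`. [this work] -/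
theorem biInter_orCoord_of_forall_eq {n : ℕ} (U : Fin n → Set (Set ι)) (e : ι) (G : Fin n → Bool) (K : Finset (Fin n)) (b : Bool)
    (hG : ∀ i ∈ K, G i = b) :
    (⋂ i ∈ K, orCoord U e G i) = (if b = true then (⋂ i ∈ K, U i) ∪ {ω : Set ι | e ∈ ω} else ⋂ i ∈ K, U i) := by
  rw [biInter_orCoord_eq_mixCoord]
  cases b
  · have hf : K.filter (fun i => G i = false) = K := Finset.filter_true_of_mem fun i hi => hG i hi
    rw [hf]
    ext ω; simp [mem_mixCoord]
  · have hf : K.filter (fun i => G i = false) = ∅ :=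
      Finset.filter_false_of_mem fun i hi => by rw [hG i hi]; decide
    rw [hf]
    ext ω
    simp only [mem_mixCoord, Finset.notMem_empty, Set.iInter_of_empty, Set.iInter_univ, Set.mem_univ, and_true, if_true, Set.mem_union,
      Set.mem_setOf_eq]

/-- **Plain three-slot cells**: if `G` is constant on each index set `K_j`, the cell is comb-positive — gen 4's disjunctive closure at order 3 on the member triple.
[this work] -/
theorem combPos_threeSlot_plain (U : Fin 4 → Set (Set ι)) (e : ι) (hUup : ∀ j, IsUpperSet (U j)) (hUe : ∀ (j : Fin 4) (b : Bool), secAt e b (U j) = U j)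
    (hU : CombHereditary U) (G : Fin 4 → Bool) (K : Fin 3 → Finset (Fin 4)) (b : Fin 3 → Bool) (hKb : ∀ j, ∀ i ∈ K j, G i = b j) :
    CombPos (fun _ : ι => 3) (fun p => sahiE (bernoulliWeight p) 3 (fun j => ind (⋂ i ∈ K j, orCoord U e G i))) := by
  set M : Fin 3 → Set (Set ι) := fun j => ⋂ i ∈ K j, U i with hM
  have hMup : ∀ j, IsUpperSet (M j) := fun j => SahiCombHereditary.isUpperSet_biInter hUup (K j)
  have hMe : ∀ (j : Fin 3) (c : Bool), secAt e c (M j) = M j := fun j c => secAt_biInter U e hUe (K j) c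
  have h3 : CombPos (fun _ : ι => 3) (fun p => sahiE (bernoulliWeight p) 3 (fun j => ind (M j))) := hU 3 K
  have key := SahiCombDisjunct.combPos_sahiE_three_unionCoord M hMup e hMe h3 (fun j => b j = true)
  refine key.congr fun p => ?_
  congr 1; funext j
  rw [biInter_orCoord_of_forall_eq U e G (K j) (b j) (hKb j)]

/-! ### The four dispatchers -/

/-- **`CombCanonThreeSlotCells 0`**: all sixteen three-slot cells of canonical type `({0},{1},{2})` at the comb level (case split on `G`; plain cells by
`combPos_threeSlot_plain`, the others by the lifted certificate cells `comb_threeSlot_k0_F…`). [this work] -/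
theorem combCanonThreeSlotCells_zero : CombCanonThreeSlotCells 0 := by
  intro ι _ U e hUup hUe hU G
  have hG : G = ![G 0, G 1, G 2, G 3] := by funext i; fin_cases i <;> rfl
  rw [hG, SahiMixture.canonK_zero]
  cases G 0 <;> cases G 1 <;> cases G 2 <;> cases G 3
  · exact combPos_threeSlot_plain U e hUup hUe hU _ _ ![false, false, false] (by decide)
  · exact combPos_threeSlot_plain U e hUup hUe hU _ _ ![false, false, false] (by decide)
  · exact combPos_threeSlot_plain U e hUup hUe hU _ _ ![false, false, true] (by decide)
  · exact combPos_threeSlot_plain U e hUup hUe hU _ _ ![false, false, true] (by decide)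
  · exact combPos_threeSlot_plain U e hUup hUe hU _ _ ![false, true, false] (by decide)
  · exact combPos_threeSlot_plain U e hUup hUe hU _ _ ![false, true, false] (by decide)
  · exact combPos_threeSlot_plain U e hUup hUe hU _ _ ![false, true, true] (by decide)
  · exact combPos_threeSlot_plain U e hUup hUe hU _ _ ![false, true, true] (by decide)
  · exact combPos_threeSlot_plain U e hUup hUe hU _ _ ![true, false, false] (by decide)
  · exact combPos_threeSlot_plain U e hUup hUe hU _ _ ![true, false, false] (by decide)
  · exact combPos_threeSlot_plain U e hUup hUe hU _ _ ![true, false, true] (by decide)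
  · exact combPos_threeSlot_plain U e hUup hUe hU _ _ ![true, false, true] (by decide)
  · exact combPos_threeSlot_plain U e hUup hUe hU _ _ ![true, true, false] (by decide)
  · exact combPos_threeSlot_plain U e hUup hUe hU _ _ ![true, true, false] (by decide)
  · exact combPos_threeSlot_plain U e hUup hUe hU _ _ ![true, true, true] (by decide)
  · exact combPos_threeSlot_plain U e hUup hUe hU _ _ ![true, true, true] (by decide)

/-- **`CombCanonThreeSlotCells 1`**: all sixteen three-slot cells of canonical type `({0},{1},{2,3})` at the comb level (case split on `G`; plain cells by
`combPos_threeSlot_plain`, the others by the lifted certificate cells `comb_threeSlot_k1_F…`). [this work] -/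
theorem combCanonThreeSlotCells_one : CombCanonThreeSlotCells 1 := by
  intro ι _ U e hUup hUe hU G
  have hG : G = ![G 0, G 1, G 2, G 3] := by funext i; fin_cases i <;> rfl
  rw [hG, SahiMixture.canonK_one]
  cases G 0 <;> cases G 1 <;> cases G 2 <;> cases G 3
  · exact combPos_threeSlot_plain U e hUup hUe hU _ _ ![false, false, false] (by decide)
  · exact comb_threeSlot_k1_F3 U e hUe hU
  · exact comb_threeSlot_k1_F2 U e hUe hU
  · exact combPos_threeSlot_plain U e hUup hUe hU _ _ ![false, false, true] (by decide)
  · exact combPos_threeSlot_plain U e hUup hUe hU _ _ ![false, true, false] (by decide)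
  · exact comb_threeSlot_k1_F13 U e hUe hU
  · exact comb_threeSlot_k1_F12 U e hUe hU
  · exact combPos_threeSlot_plain U e hUup hUe hU _ _ ![false, true, true] (by decide)
  · exact combPos_threeSlot_plain U e hUup hUe hU _ _ ![true, false, false] (by decide)
  · exact comb_threeSlot_k1_F03 U e hUe hU
  · exact comb_threeSlot_k1_F02 U e hUe hU
  · exact combPos_threeSlot_plain U e hUup hUe hU _ _ ![true, false, true] (by decide)
  · exact combPos_threeSlot_plain U e hUup hUe hU _ _ ![true, true, false] (by decide)
  · exact comb_threeSlot_k1_F013 U e hUe hU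
  · exact comb_threeSlot_k1_F012 U e hUe hU
  · exact combPos_threeSlot_plain U e hUup hUe hU _ _ ![true, true, true] (by decide)

/-- **`CombCanonThreeSlotCells 2`**: all sixteen three-slot cells of canonical type `({0},{1,3},{2,3})` at the comb level (case split on `G`; plain cells by
`combPos_threeSlot_plain`, the others by the lifted certificate cells `comb_threeSlot_k2_F…`). [this work] -/
theorem combCanonThreeSlotCells_two : CombCanonThreeSlotCells 2 := by
  intro ι _ U e hUup hUe hU G
  have hG : G = ![G 0, G 1, G 2, G 3] := by funext i; fin_cases i <;> rfl
  rw [hG, SahiMixture.canonK_two]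
  cases G 0 <;> cases G 1 <;> cases G 2 <;> cases G 3
  · exact combPos_threeSlot_plain U e hUup hUe hU _ _ ![false, false, false] (by decide)
  · exact comb_threeSlot_k2_F3 U e hUe hU
  · exact comb_threeSlot_k2_F2 U e hUe hU
  · exact comb_threeSlot_k2_F23 U e hUe hU
  · exact comb_threeSlot_k2_F1 U e hUe hU
  · exact comb_threeSlot_k2_F13 U e hUe hU
  · exact comb_threeSlot_k2_F12 U e hUe hU
  · exact combPos_threeSlot_plain U e hUup hUe hU _ _ ![false, true, true] (by decide)
  · exact combPos_threeSlot_plain U e hUup hUe hU _ _ ![true, false, false] (by decide)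
  · exact comb_threeSlot_k2_F03 U e hUe hU
  · exact comb_threeSlot_k2_F02 U e hUe hU
  · exact comb_threeSlot_k2_F023 U e hUe hU
  · exact comb_threeSlot_k2_F01 U e hUe hU
  · exact comb_threeSlot_k2_F013 U e hUe hU
  · exact comb_threeSlot_k2_F012 U e hUe hU
  · exact combPos_threeSlot_plain U e hUup hUe hU _ _ ![true, true, true] (by decide)

/-- **`CombCanonThreeSlotCells 3`**: all sixteen three-slot cells of canonical type `({0,3},{1,3},{2,3})` at the comb level (case split on `G`; plain cells by
`combPos_threeSlot_plain`, the others by the lifted certificate cells `comb_threeSlot_k3_F…`). [this work] -/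
theorem combCanonThreeSlotCells_three : CombCanonThreeSlotCells 3 := by
  intro ι _ U e hUup hUe hU G
  have hG : G = ![G 0, G 1, G 2, G 3] := by funext i; fin_cases i <;> rfl
  rw [hG, SahiMixture.canonK_three]
  cases G 0 <;> cases G 1 <;> cases G 2 <;> cases G 3
  · exact combPos_threeSlot_plain U e hUup hUe hU _ _ ![false, false, false] (by decide)
  · exact comb_threeSlot_k3_F3 U e hUe hU
  · exact comb_threeSlot_k3_F2 U e hUe hU
  · exact comb_threeSlot_k3_F23 U e hUe hU
  · exact comb_threeSlot_k3_F1 U e hUe hU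
  · exact comb_threeSlot_k3_F13 U e hUe hU
  · exact comb_threeSlot_k3_F12 U e hUe hU
  · exact comb_threeSlot_k3_F123 U e hUe hU
  · exact comb_threeSlot_k3_F0 U e hUe hU
  · exact comb_threeSlot_k3_F03 U e hUe hU
  · exact comb_threeSlot_k3_F02 U e hUe hU
  · exact comb_threeSlot_k3_F023 U e hUe hU
  · exact comb_threeSlot_k3_F01 U e hUe hU
  · exact comb_threeSlot_k3_F013 U e hUe hU
  · exact comb_threeSlot_k3_F012 U e hUe hU
  · exact combPos_threeSlot_plain U e hUup hUe hU _ _ ![true, true, true] (by decide)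

end SahiCombMix

end Summit.CriticalPhenomena.PercolationContinuityZ3.Theorems

end
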